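import Literature.Analysis.FunctionSpaces.MeyersSerrinProofs
import Literature.Analysis.FunctionSpaces.SobolevDomainNormProofs
import HarnessLib

/-!
# Crux `BlockLipschitzL` (stmt-QuantumFields-23533) ∕ `HistoryTailL` (stmt-QuantumFields-19936), LINE 25 «CompactnessTransfer»,
# (C)-PROOF brick (C-a1) «LOCAL `L²` NETS FOR BOUNDED SOBOLEV SEQUENCES»

Cell `ym3-torus` (YM ladder rung R3 = continuum SU(2) Yang–Mills on T³ — a RUNG, NOT the Clay problem: not d = 4, not
infinite volume, not a mass gap); WIDTH helper seat `ym-ust-19936-w2` g13, (C)-PROOF lineage project (LEAD GO 13:49Z):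
`MinimisingMapCompactness_holds` by Hardt–Kinderlehrer–Lin.  Helper `--supports stmt-QuantumFields-23533`; THEOREMS ONLY
(0 `def`, 0 `sorry`, default heartbeats); imports: lit ✓`MeyersSerrinProofs` (Meyers–Serrin, smooth cut-offs), lit
✓`SobolevDomainNormProofs`; Mathlib.

WHAT THIS FILE DOES (Rellich–Kondrachov, interior form, first half).  For a sequence `u_j` of maps on an open `Ω`
(finite-dimensional real normed `E`, additive Haar `μ`, complete finite-dimensional `F`) with weak gradients `Gs_j`,
uniformly bounded VALUES `‖u_j‖ ≤ B` on `Ω` and uniformly bounded gradients `‖Gs_j‖_{L²(Ω)} ≤ Λ`, and a compact `K ⊆ Ω`: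
for every `ε > 0` there is a FINITE set of indices `s` such that every `u_j` is `ε`-close in `L²(K)` to some `u_m`,
`m ∈ s` (★★★ `exists_finset_eLpNorm_sub_lt_of_weakGrad`) — i.e. `{u_j|_K}` is totally bounded in `L²(K)`.  Proof: smooth
cut-off `χ = 1` near `K` with `tsupport χ ⊆ Ω′ ⋐ Ω`; Meyers–Serrin on `Ω′` gives `v_j ∈ C^∞(Ω′)` within `η` of `u_j` in
`W^{1,2}(Ω′)`; the tree's `C¹` Rellich net (lit ✓`exists_finset_eLpNorm_sub_lt`) for the compactly supported
`χ•v_j` (uniform `L²` bounds on `χ v_j` and `D(χ v_j)`); back to `u_j` on `K` by the triangle inequality.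
This is brick (C-a1) of the compactness theorem for ball-minimising maps into `S³` (lit
`Literature.Analysis.PDE.HarmonicMaps.MinimisingMapCompactness`): (C-a2) extracts the subsequence and the a.e. limit,
(C-a3) the weak gradient of the limit, (C-b) the HKL projection, (C-c/d/e) the competitor transfer and the knit.

HONEST SCOPE.  Sobolev compactness bookkeeping; nothing of (C), (RS), S1″, S2♭″, `hHalvingBand`, K1, `MeanDeviationL`,
`BlockLipschitzL`, `HistoryTailL` is proved here.  YM₃ on T³ is rung R3, not Clay; YM gap NOT proved.

References: L. C. Evans, Partial Differential Equations (2010) [Evans2010] (§5.7 Thm 1, §5.3); R. A. Adams, Sobolev Spaces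
(1975) [Adams1975] (Thm 6.2); L. Simon, Theorems on Regularity and Singularity of Energy Minimizing Maps (1996) [Simon1996]
(§2.9, the compactness lemma this serves).
-/

set_option autoImplicit false

noncomputable section

open MeasureTheory Set Function Filter Topology Metric TopologicalSpace
open scoped ContDiff ENNReal

namespace Summit.QuantumFields.YangMills.Theorems.PoincareLipschitzSobolevLocalL2Net

open Literature.Analysis.FunctionSpaces

variable {E : Type*} [NormedAddCommGroup E] [NormedSpace ℝ E] [FiniteDimensional ℝ E]
  [MeasurableSpace E] [BorelSpace E] {μ : Measure E} [μ.IsAddHaarMeasure]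
variable {F : Type*} [NormedAddCommGroup F] [NormedSpace ℝ F] [CompleteSpace F]

/-! ## §1 Letters -/

omit [MeasurableSpace E] [BorelSpace E] [CompleteSpace F] in
/-- **Operator norm against a basis**: `‖T‖ ≤ Σ_i ‖b*_i‖·‖T b_i‖` for the basis `Module.finBasis` and its (continuous)
coordinate functionals `b*_i`, via `v = Σ_i b*_i(v) b_i`. [folklore] -/
theorem opNorm_le_sum_basis (T : E →L[ℝ] F) :
    ‖T‖ ≤ ∑ i, ‖LinearMap.toContinuousLinearMap ((Module.finBasis ℝ E).coord i)‖ * ‖T ((Module.finBasis ℝ E) i)‖ := by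
  set b := Module.finBasis ℝ E
  refine ContinuousLinearMap.opNorm_le_bound _ (Finset.sum_nonneg fun i _ => by positivity) fun v => ?_
  have hv : T v = ∑ i, b.repr v i • T (b i) := by
    conv_lhs => rw [← b.sum_repr v]
    rw [map_sum]
    exact Finset.sum_congr rfl fun i _ => by rw [map_smul]
  rw [hv, Finset.sum_mul]
  refine (norm_sum_le _ _).trans (Finset.sum_le_sum fun i _ => ?_)
  rw [norm_smul, Real.norm_eq_abs]
  have h1 : |b.repr v i| ≤ ‖LinearMap.toContinuousLinearMap (b.coord i)‖ * ‖v‖ := by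
    have := (LinearMap.toContinuousLinearMap (b.coord i)).le_opNorm v
    rwa [LinearMap.coe_toContinuousLinearMap', Module.Basis.coord_apply, Real.norm_eq_abs] at this
  calc |b.repr v i| * ‖T (b i)‖ ≤ (‖LinearMap.toContinuousLinearMap (b.coord i)‖ * ‖v‖) * ‖T (b i)‖ :=
        mul_le_mul_of_nonneg_right h1 (norm_nonneg _)
    _ = ‖LinearMap.toContinuousLinearMap (b.coord i)‖ * ‖T (b i)‖ * ‖v‖ := by ring

omit [BorelSpace E] [CompleteSpace F] in
/-- **`L^p` norm of an operator field against a basis**: `‖T‖_{L^p(ν)} ≤ Σ_i ‖b*_i‖·‖T b_i‖_{L^p(ν)}`. [folklore] -/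
theorem eLpNorm_clm_le_sum_basis (ν : Measure E) {T : E → E →L[ℝ] F}
    (hT : ∀ i, AEStronglyMeasurable (fun x => T x ((Module.finBasis ℝ E) i)) ν) (p : ℝ≥0∞) (hp : 1 ≤ p) :
    eLpNorm T p ν ≤ ∑ i, ‖LinearMap.toContinuousLinearMap ((Module.finBasis ℝ E).coord i)‖ₑ *
      eLpNorm (fun x => T x ((Module.finBasis ℝ E) i)) p ν := by
  set b := Module.finBasis ℝ E
  set c : Fin (Module.finrank ℝ E) → ℝ := fun i => ‖LinearMap.toContinuousLinearMap (b.coord i)‖ with hc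
  have hc0 : ∀ i, 0 ≤ c i := fun i => norm_nonneg _
  have h1 : eLpNorm T p ν ≤ eLpNorm (fun x => ∑ i, c i * ‖T x (b i)‖) p ν := by
    exact eLpNorm_mono_real fun x => (opNorm_le_sum_basis (T x)).trans (le_of_eq rfl)
  refine h1.trans ?_
  have h2 : (fun x => ∑ i, c i * ‖T x (b i)‖) = ∑ i, (fun x => c i * ‖T x (b i)‖) := by
    funext x; simp [Finset.sum_apply]
  rw [h2]
  refine (eLpNorm_sum_le (fun i _ => ((hT i).norm.const_mul _)) hp).trans (Finset.sum_le_sum fun i _ => ?_)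
  have h3 : (fun x => c i * ‖T x (b i)‖) = c i • (fun x => ‖T x (b i)‖) := by
    funext x; simp [smul_eq_mul]
  rw [h3, eLpNorm_const_smul, eLpNorm_norm, Real.enorm_eq_ofReal (hc0 i), ofReal_norm]

omit [FiniteDimensional ℝ E] [MeasurableSpace E] [BorelSpace E] [CompleteSpace F] in
/-- **A compactly supported smooth cut-off times a function smooth on a neighbourhood of its support is globally
smooth** (the standard extension-by-zero; cf. lit `CompactCutoffExtension.contDiff_smul_of_tsupport_subset`, restated in
the `C¹` form used here). [folklore] -/
theorem contDiff_one_cutoff_smul {χ : E → ℝ} {g : E → F} {O : Set E} (hO : IsOpen O) (hχ : ContDiff ℝ 1 χ)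
    (hχO : tsupport χ ⊆ O) (hg : ContDiffOn ℝ 1 g O) : ContDiff ℝ 1 fun x => χ x • g x := by
  rw [contDiff_iff_contDiffAt]
  intro x
  by_cases hx : x ∈ O
  · exact hχ.contDiffAt.smul (hg.contDiffAt (hO.mem_nhds hx))
  · have hx' : x ∉ tsupport χ := fun h => hx (hχO h)
    have h0 : (fun y => χ y • g y) =ᶠ[𝓝 x] fun _ => 0 := by
      have : ∀ᶠ y in 𝓝 x, χ y = 0 := by
        have hopen : IsOpen (tsupport χ)ᶜ := (isClosed_tsupport χ).isOpen_compl
        filter_upwards [hopen.mem_nhds hx'] with y hy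
        exact image_eq_zero_of_notMem_tsupport hy
      filter_upwards [this] with y hy
      rw [hy, zero_smul]
    exact (contDiffAt_const.congr_of_eventuallyEq h0)

/-! ## §2 The local `L²` net -/

/-- ★★★ **LOCAL `L²` NETS FOR SEQUENCES BOUNDED IN `L^∞ ∩ W^{1,2}` (interior Rellich–Kondrachov, net form).**  Let
`u_j : E → F` have weak gradients `Gs_j` on the open `Ω`, `‖u_j x‖ ≤ B` on `Ω`, `‖Gs_j‖_{L²(Ω)} ≤ Λ < ∞`, and let
`K ⊆ Ω` be compact.  Then for every `ε > 0` there is a finite index set `s` with: every `u_j` is within `ε` of some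
`u_m`, `m ∈ s`, in `L²(K)`. [cite: Evans2010, §5.7 Theorem 1; Adams1975, Theorem 6.2] -/
theorem exists_finset_eLpNorm_sub_lt_of_weakGrad [FiniteDimensional ℝ F] {Ω : Opens E} {u : ℕ → E → F}
    {Gs : ℕ → E → E →L[ℝ] F} (hu : ∀ j, HasWeakFDerivOn Ω μ (u j) (Gs j)) {B : ℝ}
    (hB : ∀ j, ∀ x ∈ (Ω : Set E), ‖u j x‖ ≤ B) {Λ : ℝ≥0∞} (hΛ : Λ ≠ ⊤)
    (hGΛ : ∀ j, eLpNorm (Gs j) 2 (μ.restrict (Ω : Set E)) ≤ Λ) {K : Set E} (hK : IsCompact K)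
    (hKΩ : K ⊆ (Ω : Set E)) {ε : ℝ≥0∞} (hε : 0 < ε) :
    ∃ s : Finset ℕ, ∀ j, ∃ m ∈ s, eLpNorm (fun x => u j x - u m x) 2 (μ.restrict K) < ε := by
  -- reduce to finite `ε`
  wlog hεt : ε ≠ ⊤ generalizing ε
  · obtain ⟨s, hs⟩ := this one_pos ENNReal.one_ne_top
    refine ⟨s, fun n => (hs n).imp fun m hm => ⟨hm.1, hm.2.trans_le ?_⟩⟩
    rw [not_ne_iff.1 hεt]; exact le_top
  -- empty `K` is trivial
  by_cases hKe : K = ∅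
  · refine ⟨{0}, fun j => ⟨0, Finset.mem_singleton_self 0, ?_⟩⟩
    rw [hKe, Measure.restrict_empty, eLpNorm_measure_zero]
    exact hε
  obtain ⟨x₀, hx₀⟩ := Set.nonempty_iff_ne_empty.2 hKe
  have hB0 : 0 ≤ B := (norm_nonneg _).trans (hB 0 x₀ (hKΩ hx₀))
  -- `η := ε / 3`
  set η : ℝ≥0∞ := ε / 3 with hηdef
  have hη0 : η ≠ 0 := (ENNReal.div_pos hε.ne' (by norm_num)).ne'
  have hηt : η ≠ ⊤ := ENNReal.div_ne_top hεt (by norm_num)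
  -- (1) cut-off and a compactly contained neighbourhood
  obtain ⟨χ, hχ, hχc, hχΩ, hχK⟩ := MeyersSerrin.exists_smooth_cutoff hK Ω.isOpen hKΩ
  have hχK' : ∀ x ∈ K, χ x = 1 := fun x hx => hχK.self_of_nhdsSet x hx
  obtain ⟨δ, hδ, hδΩ⟩ := hχc.exists_cthickening_subset_open Ω.isOpen hχΩ
  set Ω' : Opens E := ⟨thickening δ (tsupport χ), isOpen_thickening⟩ with hΩ'def
  have hSΩ' : tsupport χ ⊆ (Ω' : Set E) := self_subset_thickening hδ _
  have hΩ'c : (Ω' : Set E) ⊆ cthickening δ (tsupport χ) := thickening_subset_cthickening δ _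
  have hCc : IsCompact (cthickening δ (tsupport χ)) :=
    isCompact_of_isClosed_isBounded isClosed_cthickening hχc.isBounded.cthickening
  have hΩ'Ω : (Ω' : Set E) ⊆ (Ω : Set E) := hΩ'c.trans hδΩ
  have hΩ'le : Ω' ≤ Ω := hΩ'Ω
  have hΩ'm : MeasurableSet (Ω' : Set E) := Ω'.isOpen.measurableSet
  have hΩ'fin : μ (Ω' : Set E) < ⊤ := (measure_mono hΩ'c).trans_lt hCc.measure_lt_top
  haveI : IsFiniteMeasure (μ.restrict (Ω' : Set E)) := isFiniteMeasure_restrict.2 hΩ'fin.ne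
  have hKΩ' : K ⊆ (Ω' : Set E) := fun x hx =>
    hSΩ' (subset_tsupport _ (by rw [mem_support, hχK' x hx]; exact one_ne_zero))
  -- bounds for the cut-off and its gradient
  obtain ⟨Mχ, hMχ⟩ := hχc.exists_bound_of_continuous hχ.continuous
  obtain ⟨Mχ', hMχ'⟩ := (hχc.fderiv (𝕜 := ℝ)).exists_bound_of_continuous (hχ.continuous_fderiv (by simp))
  have hMχ0 : 0 ≤ Mχ := (norm_nonneg _).trans (hMχ x₀)
  have hMχ'0 : 0 ≤ Mχ' := (norm_nonneg _).trans (hMχ' x₀)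
  -- (2) `u_j ∈ W^{1,2}(Ω')`
  have hu' : ∀ j, HasWeakFDerivOn Ω' μ (u j) (Gs j) := fun j => HasWeakFDerivOn.mono_set_holds (hu j) hΩ'le
  have hum : ∀ j, AEStronglyMeasurable (u j) (μ.restrict (Ω' : Set E)) :=
    fun j => (hu' j).locallyIntegrableOn.aestronglyMeasurable
  have huB : ∀ j, ∀ᵐ x ∂(μ.restrict (Ω' : Set E)), ‖u j x‖ ≤ B := fun j => by
    filter_upwards [ae_restrict_mem hΩ'm] with x hx
    exact hB j x (hΩ'Ω hx)
  have huL2 : ∀ j, MemLp (u j) 2 (μ.restrict (Ω' : Set E)) :=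
    fun j => (memLp_top_of_bound (hum j) B (huB j)).mono_exponent le_top
  have hGm : ∀ j, AEStronglyMeasurable (Gs j) (μ.restrict (Ω' : Set E)) :=
    fun j => (hu' j).locallyIntegrableOn_deriv.aestronglyMeasurable
  have hGL2 : ∀ j, MemLp (Gs j) 2 (μ.restrict (Ω' : Set E)) := fun j =>
    ⟨hGm j, ((eLpNorm_mono_measure _ (Measure.restrict_mono hΩ'Ω le_rfl)).trans (hGΛ j)).trans_lt hΛ.lt_top⟩
  have hmem : ∀ j, MemSobolevDomain 1 2 Ω' μ (u j) := by
    intro j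
    rw [memSobolevDomain_succ_iff]
    refine ⟨huL2 j, Gs j, hu' j, fun v => ?_⟩
    rw [memSobolevDomain_zero_iff]
    exact (hGL2 j).of_le_mul (c := ‖v‖)
      ((ContinuousLinearMap.apply ℝ F v).continuous.comp_aestronglyMeasurable (hGm j))
      (Filter.Eventually.of_forall fun x => by rw [mul_comm]; exact (Gs j x).le_opNorm v)
  -- (3) Meyers–Serrin approximants within `η`
  choose v hv hvη using fun j => MeyersSerrin.exists_contDiffOn_eSobolevDomainNorm_sub_le (Ω := Ω') (μ := μ)
    (p := 2) one_le_two ENNReal.ofNat_ne_top (hmem j) hη0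
  have hvW : ∀ j, HasWeakFDerivOn Ω' μ (v j) (fderiv ℝ (v j)) :=
    fun j => MeyersSerrin.hasWeakFDerivOn_of_contDiffOn (μ := μ) (hv j)
  have hsub : ∀ j, HasWeakFDerivOn Ω' μ (u j - v j) (Gs j - fderiv ℝ (v j)) := fun j => (hu' j).sub (hvW j)
  have hvm : ∀ j, AEStronglyMeasurable (v j) (μ.restrict (Ω' : Set E)) :=
    fun j => (hv j).continuousOn.aestronglyMeasurable hΩ'm
  have hv'm : ∀ j, AEStronglyMeasurable (fderiv ℝ (v j)) (μ.restrict (Ω' : Set E)) :=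
    fun j => ((hv j).continuousOn_fderiv_of_isOpen Ω'.isOpen (by simp)).aestronglyMeasurable hΩ'm
  -- `L²` consequences of the Sobolev-norm bound
  have hL2uv : ∀ j, eLpNorm (fun x => u j x - v j x) 2 (μ.restrict (Ω' : Set E)) ≤ η :=
    fun j => eLpNorm_le_eSobolevDomainNorm.trans (hvη j)
  set b := Module.finBasis ℝ E with hbdef
  have hL2D : ∀ j i, eLpNorm (fun x => (Gs j x - fderiv ℝ (v j) x) (b i)) 2 (μ.restrict (Ω' : Set E)) ≤ η := by
    intro j i
    have h1 := hvη j
    rw [MeyersSerrin.eSobolevDomainNorm_succ_eq (hsub j)] at h1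
    refine le_trans ?_ (le_trans le_add_self h1)
    have := Finset.single_le_sum (f := fun i => eSobolevDomainNorm 0 2 Ω' μ (fun x => (Gs j - fderiv ℝ (v j)) x (b i)))
      (fun _ _ => bot_le) (Finset.mem_univ i)
    simpa only [eSobolevDomainNorm_zero, Pi.sub_apply] using this
  -- (4) the compactly supported smooth functions `w_j := χ • v_j`
  have hw1 : ∀ j, ContDiff ℝ 1 (fun x => χ x • v j x) :=
    fun j => contDiff_one_cutoff_smul Ω'.isOpen (hχ.of_le (by simp)) hSΩ' ((hv j).of_le (by simp))
  have hwS : ∀ j, tsupport (fun x => χ x • v j x) ⊆ tsupport χ := fun j => tsupport_smul_subset_left _ _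
  have hwsupp : ∀ j, support (fun x => χ x • v j x) ⊆ (Ω' : Set E) :=
    fun j => (subset_tsupport _).trans ((hwS j).trans hSΩ')
  -- `L²` bound on `w_j`
  set A : ℝ≥0∞ := ENNReal.ofReal Mχ * (μ (Ω' : Set E) ^ (2:ℝ≥0∞).toReal⁻¹ * ENNReal.ofReal B + η) with hAdef
  have hAt : A ≠ ⊤ := ENNReal.mul_ne_top ENNReal.ofReal_ne_top
    (ENNReal.add_ne_top.2 ⟨ENNReal.mul_ne_top (ENNReal.rpow_ne_top_of_nonneg (by positivity) hΩ'fin.ne)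
      ENNReal.ofReal_ne_top, hηt⟩)
  have hvL2 : ∀ j, eLpNorm (v j) 2 (μ.restrict (Ω' : Set E)) ≤ μ (Ω' : Set E) ^ (2:ℝ≥0∞).toReal⁻¹ * ENNReal.ofReal B + η := by
    intro j
    have h1 : eLpNorm (u j) 2 (μ.restrict (Ω' : Set E)) ≤ μ (Ω' : Set E) ^ (2:ℝ≥0∞).toReal⁻¹ * ENNReal.ofReal B := by
      have := eLpNorm_le_of_ae_bound (p := 2) (huB j)
      rwa [Measure.restrict_apply_univ] at this
    have h2 : eLpNorm (v j) 2 (μ.restrict (Ω' : Set E)) ≤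
        eLpNorm (u j) 2 (μ.restrict (Ω' : Set E)) + eLpNorm (fun x => u j x - v j x) 2 (μ.restrict (Ω' : Set E)) := by
      have := eLpNorm_sub_le (hum j) ((hum j).sub (hvm j)) (p := 2) one_le_two
      refine le_trans (le_of_eq ?_) this
      congr 1; funext x; simp
    exact h2.trans (add_le_add h1 (hL2uv j))
  have hwA : ∀ j, eLpNorm (fun x => χ x • v j x) 2 μ ≤ A := by
    intro j
    rw [← eLpNorm_restrict_eq_of_support_subset (hwsupp j)]
    have h1 : eLpNorm (fun x => χ x • v j x) 2 (μ.restrict (Ω' : Set E)) ≤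
        ENNReal.ofReal Mχ * eLpNorm (v j) 2 (μ.restrict (Ω' : Set E)) :=
      eLpNorm_le_mul_eLpNorm_of_ae_le_mul (Filter.Eventually.of_forall fun x => by
        rw [norm_smul]; exact mul_le_mul_of_nonneg_right (hMχ x) (norm_nonneg _)) 2
    exact h1.trans (mul_le_mul' le_rfl (hvL2 j))
  -- `L²` bound on `D w_j`
  set D : ℝ≥0∞ := ∑ i, ‖LinearMap.toContinuousLinearMap (b.coord i)‖ₑ * (‖b i‖ₑ * Λ + η) with hDdef
  have hDt : D ≠ ⊤ := by
    refine ENNReal.sum_ne_top.2 fun i _ => ENNReal.mul_ne_top enorm_ne_top ?_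
    exact ENNReal.add_ne_top.2 ⟨ENNReal.mul_ne_top enorm_ne_top hΛ, hηt⟩
  have hDv : ∀ j, eLpNorm (fderiv ℝ (v j)) 2 (μ.restrict (Ω' : Set E)) ≤ D := by
    intro j
    have hcomp : ∀ i, AEStronglyMeasurable (fun x => fderiv ℝ (v j) x (b i)) (μ.restrict (Ω' : Set E)) :=
      fun i => (ContinuousLinearMap.apply ℝ F (b i)).continuous.comp_aestronglyMeasurable (hv'm j)
    refine (eLpNorm_clm_le_sum_basis _ hcomp 2 one_le_two).trans (Finset.sum_le_sum fun i _ => ?_)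
    refine mul_le_mul' le_rfl ?_
    -- `‖∂_i v_j‖ ≤ ‖G_j b_i‖ + ‖(G_j - ∂v_j) b_i‖`
    have hGi : AEStronglyMeasurable (fun x => Gs j x (b i)) (μ.restrict (Ω' : Set E)) :=
      (ContinuousLinearMap.apply ℝ F (b i)).continuous.comp_aestronglyMeasurable (hGm j)
    have h1 : eLpNorm (fun x => fderiv ℝ (v j) x (b i)) 2 (μ.restrict (Ω' : Set E)) ≤
        eLpNorm (fun x => Gs j x (b i)) 2 (μ.restrict (Ω' : Set E)) +
          eLpNorm (fun x => (Gs j x - fderiv ℝ (v j) x) (b i)) 2 (μ.restrict (Ω' : Set E)) := by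
      have := eLpNorm_sub_le hGi (hGi.sub (hcomp i)) (p := 2) one_le_two
      refine le_trans (le_of_eq ?_) (this.trans (le_of_eq ?_))
      · congr 1; funext x; simp
      · congr 2
    have h2 : eLpNorm (fun x => Gs j x (b i)) 2 (μ.restrict (Ω' : Set E)) ≤ ‖b i‖ₑ * Λ := by
      have h3 : eLpNorm (fun x => Gs j x (b i)) 2 (μ.restrict (Ω' : Set E)) ≤
          ENNReal.ofReal ‖b i‖ * eLpNorm (Gs j) 2 (μ.restrict (Ω' : Set E)) :=
        eLpNorm_le_mul_eLpNorm_of_ae_le_mul (Filter.Eventually.of_forall fun x => by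
          rw [mul_comm]; exact (Gs j x).le_opNorm (b i)) 2
      rw [ofReal_norm] at h3
      exact h3.trans (mul_le_mul' le_rfl ((eLpNorm_mono_measure _ (Measure.restrict_mono hΩ'Ω le_rfl)).trans (hGΛ j)))
    exact h1.trans (add_le_add h2 (hL2D j i))
  set B' : ℝ≥0∞ := ENNReal.ofReal Mχ * D + ENNReal.ofReal Mχ' * (μ (Ω' : Set E) ^ (2:ℝ≥0∞).toReal⁻¹ * ENNReal.ofReal B + η)
    with hB'def
  have hB't : B' ≠ ⊤ := ENNReal.add_ne_top.2 ⟨ENNReal.mul_ne_top ENNReal.ofReal_ne_top hDt,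
    ENNReal.mul_ne_top ENNReal.ofReal_ne_top (ENNReal.add_ne_top.2
      ⟨ENNReal.mul_ne_top (ENNReal.rpow_ne_top_of_nonneg (by positivity) hΩ'fin.ne) ENNReal.ofReal_ne_top, hηt⟩)⟩
  have hwB : ∀ j, eLpNorm (fderiv ℝ (fun x => χ x • v j x)) 2 μ ≤ B' := by
    intro j
    -- the derivative vanishes off `tsupport χ ⊆ Ω'`
    have hsupp' : ∀ x ∉ (Ω' : Set E), fderiv ℝ (fun x => χ x • v j x) x = 0 := fun x hx =>
      fderiv_of_notMem_tsupport ℝ fun h => hx (hSΩ' (hwS j h))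
    -- pointwise product rule on `Ω'`
    have hpt : ∀ x ∈ (Ω' : Set E), ‖fderiv ℝ (fun x => χ x • v j x) x‖ ≤
        Mχ * ‖fderiv ℝ (v j) x‖ + Mχ' * ‖v j x‖ := by
      intro x hx
      have hχd : DifferentiableAt ℝ χ x := (hχ.differentiable (by simp)) x
      have hvd : DifferentiableAt ℝ (v j) x :=
        ((hv j).differentiableOn (by simp)).differentiableAt (Ω'.isOpen.mem_nhds hx)
      rw [fderiv_fun_smul hχd hvd]
      refine (norm_add_le _ _).trans (add_le_add ?_ ?_)
      · rw [norm_smul]; exact mul_le_mul_of_nonneg_right (hMχ x) (norm_nonneg _)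
      · refine (ContinuousLinearMap.opNorm_le_bound _ (by positivity) fun w => ?_)
        rw [ContinuousLinearMap.smulRight_apply, norm_smul, mul_assoc, mul_comm ‖v j x‖, ← mul_assoc]
        exact mul_le_mul_of_nonneg_right ((fderiv ℝ χ x).le_of_opNorm_le (hMχ' x) w) (norm_nonneg _)
    -- a real-valued majorant supported in `Ω'`
    have hmaj : ∀ x, ‖fderiv ℝ (fun x => χ x • v j x) x‖ ≤
        ‖(Ω' : Set E).indicator (fun x => Mχ * ‖fderiv ℝ (v j) x‖ + Mχ' * ‖v j x‖) x‖ := by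
      intro x
      by_cases hx : x ∈ (Ω' : Set E)
      · rw [Set.indicator_of_mem hx, Real.norm_eq_abs, abs_of_nonneg (by positivity)]
        exact hpt x hx
      · rw [hsupp' x hx, norm_zero]; exact norm_nonneg _
    refine (eLpNorm_mono hmaj).trans ?_
    rw [eLpNorm_indicator_eq_eLpNorm_restrict hΩ'm]
    have hm1 : AEStronglyMeasurable (fun x => Mχ * ‖fderiv ℝ (v j) x‖) (μ.restrict (Ω' : Set E)) :=
      (hv'm j).norm.const_mul _
    have hm2 : AEStronglyMeasurable (fun x => Mχ' * ‖v j x‖) (μ.restrict (Ω' : Set E)) := (hvm j).norm.const_mul _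
    refine (eLpNorm_add_le hm1 hm2 one_le_two).trans (add_le_add ?_ ?_)
    · have : (fun x => Mχ * ‖fderiv ℝ (v j) x‖) = Mχ • (fun x => ‖fderiv ℝ (v j) x‖) := by funext x; simp [smul_eq_mul]
      rw [this, eLpNorm_const_smul, eLpNorm_norm, Real.enorm_eq_ofReal hMχ0]
      exact mul_le_mul' le_rfl (hDv j)
    · have : (fun x => Mχ' * ‖v j x‖) = Mχ' • (fun x => ‖v j x‖) := by funext x; simp [smul_eq_mul]
      rw [this, eLpNorm_const_smul, eLpNorm_norm, Real.enorm_eq_ofReal hMχ'0]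
      exact mul_le_mul' le_rfl (hvL2 j)
  -- (5) the `C¹` Rellich net for `w_j`
  obtain ⟨s, hs⟩ := exists_finset_eLpNorm_sub_lt μ (p := 2) one_le_two hχc (fun j => fun x => χ x • v j x)
    hw1 hwS hAt hB't hwA hwB (pos_iff_ne_zero.2 hη0)
  refine ⟨s, fun j => ?_⟩
  obtain ⟨m, hm, hjm⟩ := hs j
  refine ⟨m, hm, ?_⟩
  -- (6) back to `u` on `K`
  have hKm : MeasurableSet K := hK.measurableSet
  have hresK : μ.restrict K ≤ μ.restrict (Ω' : Set E) := Measure.restrict_mono hKΩ' le_rfl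
  have humK : ∀ j, AEStronglyMeasurable (u j) (μ.restrict K) := fun j => (hum j).mono_measure hresK
  have hvmK : ∀ j, AEStronglyMeasurable (v j) (μ.restrict K) := fun j => (hvm j).mono_measure hresK
  have e1 : eLpNorm (fun x => u j x - v j x) 2 (μ.restrict K) ≤ η :=
    (eLpNorm_mono_measure _ hresK).trans (hL2uv j)
  have e3 : eLpNorm (fun x => v m x - u m x) 2 (μ.restrict K) ≤ η := by
    have := (eLpNorm_mono_measure (fun x => u m x - v m x) hresK).trans (hL2uv m)
    rwa [← eLpNorm_neg, show -(fun x => u m x - v m x) = fun x => v m x - u m x by funext x; simp] at this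
  have e2 : eLpNorm (fun x => v j x - v m x) 2 (μ.restrict K) < η := by
    have hK1 : eLpNorm (fun x => v j x - v m x) 2 (μ.restrict K) =
        eLpNorm (fun x => χ x • v j x - χ x • v m x) 2 (μ.restrict K) := by
      refine eLpNorm_congr_ae ?_
      filter_upwards [ae_restrict_mem hKm] with x hx
      rw [hχK' x hx, one_smul, one_smul]
    rw [hK1]
    refine lt_of_le_of_lt (eLpNorm_mono_measure _ Measure.restrict_le_self) ?_
    have : (fun x => χ x • v j x - χ x • v m x) = ((fun x => χ x • v j x) - fun x => χ x • v m x) := rfl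
    rw [this]; exact hjm
  have hsplit : (fun x => u j x - u m x) =
      fun x => ((u j x - v j x) + (v j x - v m x)) + (v m x - u m x) := by funext x; abel
  rw [hsplit]
  have m12 : AEStronglyMeasurable (fun x => (u j x - v j x) + (v j x - v m x)) (μ.restrict K) :=
    ((humK j).sub (hvmK j)).add ((hvmK j).sub (hvmK m))
  calc eLpNorm (fun x => ((u j x - v j x) + (v j x - v m x)) + (v m x - u m x)) 2 (μ.restrict K)
      ≤ eLpNorm (fun x => (u j x - v j x) + (v j x - v m x)) 2 (μ.restrict K) +
          eLpNorm (fun x => v m x - u m x) 2 (μ.restrict K) := eLpNorm_add_le m12 ((hvmK m).sub (humK m)) one_le_two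
    _ ≤ (eLpNorm (fun x => u j x - v j x) 2 (μ.restrict K) + eLpNorm (fun x => v j x - v m x) 2 (μ.restrict K)) +
          eLpNorm (fun x => v m x - u m x) 2 (μ.restrict K) :=
        add_le_add (eLpNorm_add_le ((humK j).sub (hvmK j)) ((hvmK j).sub (hvmK m)) one_le_two) le_rfl
    _ < (η + η) + η := by
        refine ENNReal.add_lt_add_of_lt_of_le (ne_top_of_le_ne_top hηt e3) ?_ e3
        exact ENNReal.add_lt_add_of_le_of_lt (ne_top_of_le_ne_top hηt e1) e1 e2
    _ = ε := by rw [hηdef, ENNReal.add_thirds]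

end Summit.QuantumFields.YangMills.Theorems.PoincareLipschitzSobolevLocalL2Net

end
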